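import Summits.BirchSwinnertonDyer.BirchSwinnertonDyer.Theorems.ByReductionTypeAtTwoTowerLayerSharp
import Literature.NumberTheory.EllipticCurves.Greenberg1999.ControlLocalKernelsLayerGoodProofs
import Literature.NumberTheory.EllipticCurves.Greenberg1999.ControlLocalKernelsLayerBoundProofs
import HarnessLib

/-!
# The sharp-exponent β-currency TOWER doors of `…TowerLayerSharp` with Greenberg's Lemma 3.3 FED BY
# NAME (route ByReductionTypeAtTwo, crux `OrdKatoHalfAtTwo`, item stmt-BirchSwinnertonDyer-19271; seat
# bsd-2adic-tower-eng GEN 7, WAKE `plan/WAKE-IDLE-2ADIC-h33-rekey.md`)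

HONEST FRAMING (cell `bsd-2adic`, run/shared/lean/pub/bsd-2adic/, HUMAN RULINGS D-0036/D-0054/D-0074/
D-0152): door THEOREMS only; no definition; no new named fact; no `sorry`; closes nothing by itself;
nothing is booked; BSD is NOT proved by any of this. The existing door file is untouched (append-only
tree); this file re-issues its six DISPLAYS with fewer PRINT binders.

Part 6 (`…TowerLayerSharp.lean`, seat bsd-2adic-tower-1 GEN 2) displays, at the local error terms of
the TOWER gap certificate with the SHARP cover count `N_v = 2^{min(j', v₂(ℓ_v² − 1) − 3)}` at the odd
`v ∈ S`, three PRINT binders: `h33g : lemma33_localTowerKerPrimary_eq_bot_of_good.{0}` (LNM 1716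
Lemma 3.3, good `v ∤ 2`), `h33 : lemma33_natCard_localTowerKerPrimary_le.{0}` (Lemma 3.3 eq. (4), any
`v ∤ 2`) and `h34 : lemma34_natCard_localTowerKerPrimary_eq_rat` (Lemma 3.4 for `ℚ`, `v ∣ 2`). The
first two are THEOREMS of the tree — `lemma33_localTowerKerPrimary_eq_bot_of_good_holds`
(`Greenberg1999/ControlLocalKernelsLayerGoodProofs`, tower-1 GEN 3, universe-polymorphic) and
`lemma33_natCard_localTowerKerPrimary_le_holds` (`Greenberg1999/ControlLocalKernelsLayerBoundProofs`,
bsd-cited r20, p614793, universe `0`). This file (the WAKE, literal) re-issues the six displays with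
BOTH fed BY NAME and `h34` kept as the one remaining TOWER print binder:

* `towerGapAtTwo_of_layerSelmer_of_lemma34_sharp` — `O1.TowerGapAtTwo W`;
* `bsdp_two_of_layerSelmer_of_lemma34_sharp`, `mazurMainConjecture_two_of_layerSelmer_of_lemma34_sharp`,
  `katoHalfAt_two_of_layerSelmer_of_lemma34_sharp` — the rank / `λ_an` / `μ_an` road;
* `bsdp_two_of_layerSelmer_of_lemma34_sharp_of_missingLowerBoundAt`,
  `mazurMainConjecture_two_of_layerSelmer_of_lemma34_sharp_of_missingLowerBoundAt` — the `Ш`-currency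
  road (rank `0`; no `hrank` / `λ_an` / `μ_an` / Prop. 4.14).

Statements = part 6's verbatim minus the two binders; proofs = part 6's doors applied to the two
terms. The same six displays with `h34` ALSO discharged (no tower print binder at all) are the sibling
file `…TowerLayerSharpBetaKernel`; the crude-exponent family is `…TowerLayerGreenbergH33Free`.

References: R. Greenberg, LNM 1716 (1999), §3 Lemmas 3.3–3.5 (PDF pp. 86–90), Thm. 4.1, Prop. 4.14;
K. Kato, Astérisque 295 (2004), Thm. 17.4; L. Washington, *Introduction to Cyclotomic Fields*, §13.
-/

set_option autoImplicit false
-- the Theorems namespace of this sub repeats the summit name by design (D-0017 nested layout: Summit.<S>.<Sub>)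
set_option linter.dupNamespace false

noncomputable section

open scoped Classical MatrixGroups ModularForm

open NumberField IsDedekindDomain CongruenceSubgroup WeierstrassCurve Literature.NumberTheory.EllipticCurves
  Literature.NumberTheory.EllipticCurves.ModularForms Literature.NumberTheory.EllipticCurves.Rank1Residual
  Literature.NumberTheory.EllipticCurves.Rank1Residual.Typed
  Literature.NumberTheory.EllipticCurves.Greenberg1999
  Summit.BirchSwinnertonDyer.Rank1Residual.X1.MuLambda
  Summit.BirchSwinnertonDyer.Rank1Residual.X1.MuPart
  Summit.BirchSwinnertonDyer.Rank1Residual.X1.ParitySqueeze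
  Summit.BirchSwinnertonDyer.BirchSwinnertonDyer.Theorems.Rank1ResidualX1Defs
  Summit.BirchSwinnertonDyer.Rank1Residual.X5 Summit.BirchSwinnertonDyer.Rank1Residual.X5.O1
  Summit.BirchSwinnertonDyer.Rank1Residual.X5.TowerGap
  Summit.BirchSwinnertonDyer.Rank1Residual

namespace Summit.BirchSwinnertonDyer.BirchSwinnertonDyer.Theorems.KatoHalfPinch

section Curve

variable (W : WeierstrassCurve ℚ) [W.IsElliptic] [W.IsGloballyMinimal]

/-- **The GAP certificate, SHARP covers, from Lemma 3.4@2 + certificates**: part 6's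
`towerGapAtTwo_of_layerSelmer_of_greenberg_sharp` with BOTH parts of Greenberg's Lemma 3.3 supplied by
the tree's theorems `lemma33_localTowerKerPrimary_eq_bot_of_good_holds` /
`lemma33_natCard_localTowerKerPrimary_le_holds`; arithmetic
`2^d · ∏_{v ∈ S} (2 ∈ v ? |Ẽ(𝔽₂)_2|² : β_v^{N_v}) < 2^{2^{j'} − 2^j + a}`, `N_v = 2^{min(j', v₂(ℓ_v² − 1) − 3)}`.
[cite: GreenbergLNM1716, §3 Lemmas 3.3, 3.4, 3.5 (PDF pp. 86–90)] [cite: Washington1997, §13.1] -/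
theorem towerGapAtTwo_of_layerSelmer_of_lemma34_sharp
    (h34 : lemma34_natCard_localTowerKerPrimary_eq_rat)
    (hgo : GoodOrd W 2) (htors : ¬ 2 ∣ W.torsionOrder) {j j' a d : ℕ} (hjj' : j ≤ j')
    (S : Finset (HeightOneSpectrum (𝓞 ℚ)))
    (hS : ∀ v ∉ S, ((2 : ℕ) : 𝓞 ℚ) ∉ v.asIdeal ∧ W.HasGoodReductionAt v)
    (β : HeightOneSpectrum (𝓞 ℚ) → ℕ)
    (hβ : ∀ κ : ZpExtension ℚ 2, κ.IsCyclotomic → ∀ v ∈ S, ((2 : ℕ) : 𝓞 ℚ) ∉ v.asIdeal →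
      Nat.card (↥(W.localTopPrimary κ (v.adicCompletion ℚ)) ⧸
        W.localTopPrimaryDiv κ (v.adicCompletion ℚ)) ≤ β v)
    (hlow : ∀ κ : ZpExtension ℚ 2, κ.IsCyclotomic →
      2 ^ a ≤ Nat.card {z : W.selmerLayer κ j // 2 • z = 0})
    (hup : ∀ κ : ZpExtension ℚ 2, κ.IsCyclotomic →
      Nat.card {z : W.selmerLayer κ j' // 2 • z = 0} ≤ 2 ^ d)
    (harith : 2 ^ d * ∏ v ∈ S,
        (if ((2 : ℕ) : 𝓞 ℚ) ∈ v.asIdeal then (2 ^ padicValNat 2 (W.reductionPointCount 2)) ^ 2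
          else β v) ^
        (if ((2 : ℕ) : 𝓞 ℚ) ∈ v.asIdeal then 1
          else 2 ^ min j' (padicValNat 2 (Rat.HeightOneSpectrum.natGenerator v ^ 2 - 1) - 3)) <
      2 ^ (2 ^ j' - 2 ^ j + a)) : TowerGapAtTwo W :=
  towerGapAtTwo_of_layerSelmer_of_greenberg_sharp W lemma33_localTowerKerPrimary_eq_bot_of_good_holds.{0}
    lemma33_natCard_localTowerKerPrimary_le_holds h34 hgo htors hjj' S hS β hβ hlow hup harith

/-! ### The rank / `λ_an` / `μ_an` road -/

/-- **Door (TOWER, sharp covers; Lemma 3.3 fed by name) for `BSD(E,2)` at analytic rank `0`** on a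
good-ordinary-at-`2` curve with odd torsion order: PRINT {modularity, GZK, Kato 17.4 (1)(2)@2,
Greenberg Thm. 4.1@2, Prop. 4.14@2, Lemma 3.4@2} + CERTIFICATES {`hper₀`, `μ_an = 0`, `λ_an = n`,
`2^n ≤ #Sel_{2^∞}(E/ℚ_{j₀})[2]`, `2^a ≤ #Sel_{2^∞}(E/ℚ_j)[2]`, `#Sel_{2^∞}(E/ℚ_{j'})[2] ≤ 2^d`, `β_v`,
sharp arithmetic} ⇒ `BSDp W 2` (part 6's `bsdp_two_of_layerSelmer_of_greenberg_sharp`, `h33g`/`h33`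
fed). [cite: GreenbergLNM1716, Thm. 4.1, Prop. 4.14, §3 Lemmas 3.3–3.5]
[cite: Kato2004Asterisque, Thm. 17.4 (1)(2) (p. 273)] [cite: Miller2011LMS, Def. 1.1] -/
theorem bsdp_two_of_layerSelmer_of_lemma34_sharp (hmod : nonempty_modularParametrizationData)
    (hGZK : rank_eq_analyticRank_of_analyticRank_le_one)
    (h17 : ∀ [NeZero (W.conductorNorm ℤ)] (f : CuspForm (Gamma0 (W.conductorNorm ℤ)) 2),
      kato_divisibility_allPrimes W 2 (f := f))
    (hEC : TwoAdicEulerCharRankZero W 0) (h414 : prop414_noFiniteSubmodule_of_not_dvd_torsionOrder)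
    (h34 : lemma34_natCard_localTowerKerPrimary_eq_rat)
    (hper₀ : ∀ [NeZero (W.conductorNorm ℤ)] (f : CuspForm (Gamma0 (W.conductorNorm ℤ)) 2),
      IsNewformOf W f → ∀ ϖ : ℚ, (ϖ : ℝ) * W.realPeriodRat = plusPeriod f → 0 ≤ padicValRat 2 ϖ)
    (hgo : GoodOrd W 2) (hr : W.analyticRank = 0) (htors : ¬ 2 ∣ W.torsionOrder) {n j₀ j j' a d : ℕ}
    (hrank : ∀ κ : ZpExtension ℚ 2, κ.IsCyclotomic →
      2 ^ n ≤ Nat.card {z : W.selmerLayer κ j₀ // 2 • z = 0})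
    (hjj' : j ≤ j') (S : Finset (HeightOneSpectrum (𝓞 ℚ)))
    (hS : ∀ v ∉ S, ((2 : ℕ) : 𝓞 ℚ) ∉ v.asIdeal ∧ W.HasGoodReductionAt v)
    (β : HeightOneSpectrum (𝓞 ℚ) → ℕ)
    (hβ : ∀ κ : ZpExtension ℚ 2, κ.IsCyclotomic → ∀ v ∈ S, ((2 : ℕ) : 𝓞 ℚ) ∉ v.asIdeal →
      Nat.card (↥(W.localTopPrimary κ (v.adicCompletion ℚ)) ⧸
        W.localTopPrimaryDiv κ (v.adicCompletion ℚ)) ≤ β v)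
    (hlow : ∀ κ : ZpExtension ℚ 2, κ.IsCyclotomic →
      2 ^ a ≤ Nat.card {z : W.selmerLayer κ j // 2 • z = 0})
    (hup : ∀ κ : ZpExtension ℚ 2, κ.IsCyclotomic →
      Nat.card {z : W.selmerLayer κ j' // 2 • z = 0} ≤ 2 ^ d)
    (harith : 2 ^ d * ∏ v ∈ S,
        (if ((2 : ℕ) : 𝓞 ℚ) ∈ v.asIdeal then (2 ^ padicValNat 2 (W.reductionPointCount 2)) ^ 2
          else β v) ^
        (if ((2 : ℕ) : 𝓞 ℚ) ∈ v.asIdeal then 1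
          else 2 ^ min j' (padicValNat 2 (Rat.HeightOneSpectrum.natGenerator v ^ 2 - 1) - 3)) <
      2 ^ (2 ^ j' - 2 ^ j + a))
    (hlan : AnalyticLambdaEq W 2 n) (hμan : AnalyticMuLE W 2 0) : BSDp W 2 :=
  bsdp_two_of_layerSelmer_of_greenberg_sharp W hmod hGZK h17 hEC h414
    lemma33_localTowerKerPrimary_eq_bot_of_good_holds.{0} lemma33_natCard_localTowerKerPrimary_le_holds
    h34 hper₀ hgo hr htors hrank hjj' S hS β hβ hlow hup harith hlan hμan

/-- **Door (TOWER, sharp covers; Lemma 3.3 fed by name): `MazurMainConjecture W 2`** — any analytic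
rank, odd torsion order (part 6's `mazurMainConjecture_two_of_layerSelmer_of_greenberg_sharp`,
`h33g`/`h33` fed). [cite: Kato2004Asterisque, Thm. 17.4 (1)(2) (p. 273)]
[cite: GreenbergLNM1716, Prop. 4.14, §3 Lemmas 3.3–3.5] -/
theorem mazurMainConjecture_two_of_layerSelmer_of_lemma34_sharp
    (h17 : ∀ [NeZero (W.conductorNorm ℤ)] (f : CuspForm (Gamma0 (W.conductorNorm ℤ)) 2),
      kato_divisibility_allPrimes W 2 (f := f))
    (h414 : prop414_noFiniteSubmodule_of_not_dvd_torsionOrder)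
    (h34 : lemma34_natCard_localTowerKerPrimary_eq_rat)
    (hper₀ : ∀ [NeZero (W.conductorNorm ℤ)] (f : CuspForm (Gamma0 (W.conductorNorm ℤ)) 2),
      IsNewformOf W f → ∀ ϖ : ℚ, (ϖ : ℝ) * W.realPeriodRat = plusPeriod f → 0 ≤ padicValRat 2 ϖ)
    (hgo : GoodOrd W 2) (htors : ¬ 2 ∣ W.torsionOrder) {n j₀ j j' a d : ℕ}
    (hrank : ∀ κ : ZpExtension ℚ 2, κ.IsCyclotomic →
      2 ^ n ≤ Nat.card {z : W.selmerLayer κ j₀ // 2 • z = 0})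
    (hjj' : j ≤ j') (S : Finset (HeightOneSpectrum (𝓞 ℚ)))
    (hS : ∀ v ∉ S, ((2 : ℕ) : 𝓞 ℚ) ∉ v.asIdeal ∧ W.HasGoodReductionAt v)
    (β : HeightOneSpectrum (𝓞 ℚ) → ℕ)
    (hβ : ∀ κ : ZpExtension ℚ 2, κ.IsCyclotomic → ∀ v ∈ S, ((2 : ℕ) : 𝓞 ℚ) ∉ v.asIdeal →
      Nat.card (↥(W.localTopPrimary κ (v.adicCompletion ℚ)) ⧸
        W.localTopPrimaryDiv κ (v.adicCompletion ℚ)) ≤ β v)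
    (hlow : ∀ κ : ZpExtension ℚ 2, κ.IsCyclotomic →
      2 ^ a ≤ Nat.card {z : W.selmerLayer κ j // 2 • z = 0})
    (hup : ∀ κ : ZpExtension ℚ 2, κ.IsCyclotomic →
      Nat.card {z : W.selmerLayer κ j' // 2 • z = 0} ≤ 2 ^ d)
    (harith : 2 ^ d * ∏ v ∈ S,
        (if ((2 : ℕ) : 𝓞 ℚ) ∈ v.asIdeal then (2 ^ padicValNat 2 (W.reductionPointCount 2)) ^ 2
          else β v) ^
        (if ((2 : ℕ) : 𝓞 ℚ) ∈ v.asIdeal then 1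
          else 2 ^ min j' (padicValNat 2 (Rat.HeightOneSpectrum.natGenerator v ^ 2 - 1) - 3)) <
      2 ^ (2 ^ j' - 2 ^ j + a))
    (hlan : AnalyticLambdaEq W 2 n) (hμan : AnalyticMuLE W 2 0) : MazurMainConjecture W 2 :=
  mazurMainConjecture_two_of_layerSelmer_of_greenberg_sharp W h17 h414
    lemma33_localTowerKerPrimary_eq_bot_of_good_holds.{0} lemma33_natCard_localTowerKerPrimary_le_holds
    h34 hper₀ hgo htors hrank hjj' S hS β hβ hlow hup harith hlan hμan

/-- **The Kato–Néron half (the item `OrdKatoHalfAtTwo` AT `W`), sharp covers, Lemma 3.3 fed by name**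
(part 6's `katoHalfAt_two_of_layerSelmer_of_greenberg_sharp`, `h33g`/`h33` fed).
[cite: Kato2004Asterisque, Thm. 17.4 (1)(2) (p. 273)] [cite: GreenbergLNM1716, Prop. 4.14, §3 Lemmas 3.3–3.5] -/
theorem katoHalfAt_two_of_layerSelmer_of_lemma34_sharp
    (h17 : ∀ [NeZero (W.conductorNorm ℤ)] (f : CuspForm (Gamma0 (W.conductorNorm ℤ)) 2),
      kato_divisibility_allPrimes W 2 (f := f))
    (h414 : prop414_noFiniteSubmodule_of_not_dvd_torsionOrder)
    (h34 : lemma34_natCard_localTowerKerPrimary_eq_rat)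
    (hper₀ : ∀ [NeZero (W.conductorNorm ℤ)] (f : CuspForm (Gamma0 (W.conductorNorm ℤ)) 2),
      IsNewformOf W f → ∀ ϖ : ℚ, (ϖ : ℝ) * W.realPeriodRat = plusPeriod f → 0 ≤ padicValRat 2 ϖ)
    (hgo : GoodOrd W 2) (htors : ¬ 2 ∣ W.torsionOrder) {n j₀ j j' a d : ℕ}
    (hrank : ∀ κ : ZpExtension ℚ 2, κ.IsCyclotomic →
      2 ^ n ≤ Nat.card {z : W.selmerLayer κ j₀ // 2 • z = 0})
    (hjj' : j ≤ j') (S : Finset (HeightOneSpectrum (𝓞 ℚ)))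
    (hS : ∀ v ∉ S, ((2 : ℕ) : 𝓞 ℚ) ∉ v.asIdeal ∧ W.HasGoodReductionAt v)
    (β : HeightOneSpectrum (𝓞 ℚ) → ℕ)
    (hβ : ∀ κ : ZpExtension ℚ 2, κ.IsCyclotomic → ∀ v ∈ S, ((2 : ℕ) : 𝓞 ℚ) ∉ v.asIdeal →
      Nat.card (↥(W.localTopPrimary κ (v.adicCompletion ℚ)) ⧸
        W.localTopPrimaryDiv κ (v.adicCompletion ℚ)) ≤ β v)
    (hlow : ∀ κ : ZpExtension ℚ 2, κ.IsCyclotomic →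
      2 ^ a ≤ Nat.card {z : W.selmerLayer κ j // 2 • z = 0})
    (hup : ∀ κ : ZpExtension ℚ 2, κ.IsCyclotomic →
      Nat.card {z : W.selmerLayer κ j' // 2 • z = 0} ≤ 2 ^ d)
    (harith : 2 ^ d * ∏ v ∈ S,
        (if ((2 : ℕ) : 𝓞 ℚ) ∈ v.asIdeal then (2 ^ padicValNat 2 (W.reductionPointCount 2)) ^ 2
          else β v) ^
        (if ((2 : ℕ) : 𝓞 ℚ) ∈ v.asIdeal then 1
          else 2 ^ min j' (padicValNat 2 (Rat.HeightOneSpectrum.natGenerator v ^ 2 - 1) - 3)) <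
      2 ^ (2 ^ j' - 2 ^ j + a))
    (hlan : AnalyticLambdaEq W 2 n) (hμan : AnalyticMuLE W 2 0) :
    MainConjectureLowerDivisibilityAtTwoOrd W :=
  katoHalfAt_two_of_layerSelmer_of_greenberg_sharp W h17 h414
    lemma33_localTowerKerPrimary_eq_bot_of_good_holds.{0} lemma33_natCard_localTowerKerPrimary_le_holds
    h34 hper₀ hgo htors hrank hjj' S hS β hβ hlow hup harith hlan hμan

/-! ### The `Ш`-currency road (rank `0`; no `hrank` / `λ_an` / `μ_an` / Prop. 4.14) -/

/-- **Door (TOWER gap ∘ `Ш`-currency, sharp covers; Lemma 3.3 fed by name) for `BSD(E,2)` at analytic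
rank `0`** on a good-ordinary-at-`2` curve with odd torsion order: PRINT {modularity, GZK, Kato 17.4
(1)(2)@2, Greenberg Thm. 4.1@2, Lemma 3.4@2} + CERTIFICATES {`hper₀`, `hlow`, `hup`, `β_v`, sharp
arithmetic, `MissingLowerBoundAt W 2`} ⇒ `BSDp W 2` (part 6's
`bsdp_two_of_layerSelmer_of_greenberg_sharp_of_missingLowerBoundAt`, `h33g`/`h33` fed).
[cite: GreenbergLNM1716, Thm. 4.1 (p. 102), §3 Lemmas 3.3–3.5] [cite: Kato2004Asterisque, Thm. 17.4 (1)(2) (p. 273)]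
[cite: Miller2011LMS, Def. 1.1] [cite: Washington1997, §13.2] -/
theorem bsdp_two_of_layerSelmer_of_lemma34_sharp_of_missingLowerBoundAt
    (hmod : nonempty_modularParametrizationData) (hGZK : rank_eq_analyticRank_of_analyticRank_le_one)
    (h17 : ∀ [NeZero (W.conductorNorm ℤ)] (f : CuspForm (Gamma0 (W.conductorNorm ℤ)) 2),
      kato_divisibility_allPrimes W 2 (f := f))
    (hEC : TwoAdicEulerCharRankZero W 0)
    (h34 : lemma34_natCard_localTowerKerPrimary_eq_rat)
    (hper₀ : ∀ [NeZero (W.conductorNorm ℤ)] (f : CuspForm (Gamma0 (W.conductorNorm ℤ)) 2),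
      IsNewformOf W f → ∀ ϖ : ℚ, (ϖ : ℝ) * W.realPeriodRat = plusPeriod f → 0 ≤ padicValRat 2 ϖ)
    (hgo : GoodOrd W 2) (hr : W.analyticRank = 0) (htors : ¬ 2 ∣ W.torsionOrder) {j j' a d : ℕ}
    (hjj' : j ≤ j') (S : Finset (HeightOneSpectrum (𝓞 ℚ)))
    (hS : ∀ v ∉ S, ((2 : ℕ) : 𝓞 ℚ) ∉ v.asIdeal ∧ W.HasGoodReductionAt v)
    (β : HeightOneSpectrum (𝓞 ℚ) → ℕ)
    (hβ : ∀ κ : ZpExtension ℚ 2, κ.IsCyclotomic → ∀ v ∈ S, ((2 : ℕ) : 𝓞 ℚ) ∉ v.asIdeal →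
      Nat.card (↥(W.localTopPrimary κ (v.adicCompletion ℚ)) ⧸
        W.localTopPrimaryDiv κ (v.adicCompletion ℚ)) ≤ β v)
    (hlow : ∀ κ : ZpExtension ℚ 2, κ.IsCyclotomic →
      2 ^ a ≤ Nat.card {z : W.selmerLayer κ j // 2 • z = 0})
    (hup : ∀ κ : ZpExtension ℚ 2, κ.IsCyclotomic →
      Nat.card {z : W.selmerLayer κ j' // 2 • z = 0} ≤ 2 ^ d)
    (harith : 2 ^ d * ∏ v ∈ S,
        (if ((2 : ℕ) : 𝓞 ℚ) ∈ v.asIdeal then (2 ^ padicValNat 2 (W.reductionPointCount 2)) ^ 2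
          else β v) ^
        (if ((2 : ℕ) : 𝓞 ℚ) ∈ v.asIdeal then 1
          else 2 ^ min j' (padicValNat 2 (Rat.HeightOneSpectrum.natGenerator v ^ 2 - 1) - 3)) <
      2 ^ (2 ^ j' - 2 ^ j + a))
    (hsha : MissingLowerBoundAt W 2) : BSDp W 2 :=
  bsdp_two_of_layerSelmer_of_greenberg_sharp_of_missingLowerBoundAt W hmod hGZK h17 hEC
    lemma33_localTowerKerPrimary_eq_bot_of_good_holds.{0} lemma33_natCard_localTowerKerPrimary_le_holds
    h34 hper₀ hgo hr htors hjj' S hS β hβ hlow hup harith hsha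

/-- **Door (TOWER gap ∘ `Ш`-currency, sharp covers; Lemma 3.3 fed by name): the `2`-adic main
conjecture `MazurMainConjecture W 2`** at a rank-`0` good-ordinary `W` with odd torsion order (part 6's
`mazurMainConjecture_two_of_layerSelmer_of_greenberg_sharp_of_missingLowerBoundAt`, `h33g`/`h33` fed);
in particular the item `OrdKatoHalfAtTwo` AT `W` (the `⊆` half).
[cite: Kato2004Asterisque, Thm. 17.4 (1)(2) (p. 273)] [cite: GreenbergLNM1716, Thm. 4.1 (p. 102), §3 Lemmas 3.3–3.5]
[cite: Washington1997, §13.2] -/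
theorem mazurMainConjecture_two_of_layerSelmer_of_lemma34_sharp_of_missingLowerBoundAt
    (hmod : nonempty_modularParametrizationData) (hGZK : rank_eq_analyticRank_of_analyticRank_le_one)
    (h17 : ∀ [NeZero (W.conductorNorm ℤ)] (f : CuspForm (Gamma0 (W.conductorNorm ℤ)) 2),
      kato_divisibility_allPrimes W 2 (f := f))
    (hEC : TwoAdicEulerCharRankZero W 0)
    (h34 : lemma34_natCard_localTowerKerPrimary_eq_rat)
    (hper₀ : ∀ [NeZero (W.conductorNorm ℤ)] (f : CuspForm (Gamma0 (W.conductorNorm ℤ)) 2),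
      IsNewformOf W f → ∀ ϖ : ℚ, (ϖ : ℝ) * W.realPeriodRat = plusPeriod f → 0 ≤ padicValRat 2 ϖ)
    (hgo : GoodOrd W 2) (hr : W.analyticRank = 0) (htors : ¬ 2 ∣ W.torsionOrder) {j j' a d : ℕ}
    (hjj' : j ≤ j') (S : Finset (HeightOneSpectrum (𝓞 ℚ)))
    (hS : ∀ v ∉ S, ((2 : ℕ) : 𝓞 ℚ) ∉ v.asIdeal ∧ W.HasGoodReductionAt v)
    (β : HeightOneSpectrum (𝓞 ℚ) → ℕ)
    (hβ : ∀ κ : ZpExtension ℚ 2, κ.IsCyclotomic → ∀ v ∈ S, ((2 : ℕ) : 𝓞 ℚ) ∉ v.asIdeal →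
      Nat.card (↥(W.localTopPrimary κ (v.adicCompletion ℚ)) ⧸
        W.localTopPrimaryDiv κ (v.adicCompletion ℚ)) ≤ β v)
    (hlow : ∀ κ : ZpExtension ℚ 2, κ.IsCyclotomic →
      2 ^ a ≤ Nat.card {z : W.selmerLayer κ j // 2 • z = 0})
    (hup : ∀ κ : ZpExtension ℚ 2, κ.IsCyclotomic →
      Nat.card {z : W.selmerLayer κ j' // 2 • z = 0} ≤ 2 ^ d)
    (harith : 2 ^ d * ∏ v ∈ S,
        (if ((2 : ℕ) : 𝓞 ℚ) ∈ v.asIdeal then (2 ^ padicValNat 2 (W.reductionPointCount 2)) ^ 2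
          else β v) ^
        (if ((2 : ℕ) : 𝓞 ℚ) ∈ v.asIdeal then 1
          else 2 ^ min j' (padicValNat 2 (Rat.HeightOneSpectrum.natGenerator v ^ 2 - 1) - 3)) <
      2 ^ (2 ^ j' - 2 ^ j + a))
    (hsha : MissingLowerBoundAt W 2) : MazurMainConjecture W 2 :=
  mazurMainConjecture_two_of_layerSelmer_of_greenberg_sharp_of_missingLowerBoundAt W hmod hGZK h17 hEC
    lemma33_localTowerKerPrimary_eq_bot_of_good_holds.{0} lemma33_natCard_localTowerKerPrimary_le_holds
    h34 hper₀ hgo hr htors hjj' S hS β hβ hlow hup harith hsha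

end Curve

end Summit.BirchSwinnertonDyer.BirchSwinnertonDyer.Theorems.KatoHalfPinch

end
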